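import Mathlib
import Literature.Analysis.FluidPDE.Tao2016AveragedNS.ShiftSetCascadeFlows
import Summits.NavierStokesRegularity.NavierStokesRegularity.Theses.TaoLadderRungTwoFlat
import Summits.NavierStokesRegularity.NavierStokesRegularity.Theorems.TaoLadderRungTwoFlatGappedFrontRobustPhantomFrontOn
import Summits.NavierStokesRegularity.NavierStokesRegularity.Theorems.TaoLadderRungThreeGappedFrontRobustStepTransfer
import Summits.NavierStokesRegularity.NavierStokesRegularity.Theorems.TaoLadderRungTwoFlatGappedFrontRobustV2ClosenessOn

/-! ## K_B♭ = `GappedFrontRobustV2Flat` (item stmt-NavierStokesRegularity-22988, crux of route TaoLadderRungTwoFlat;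
p1 g12 proof). MODEL lattice statements (Tao 2016 §4/§6 cascade vocabulary of `ShiftSetCascadeFlows`, the shift
set `S♭ = shiftSetFlat` with the three backscatter classes); nothing here is about the Navier–Stokes equations.

THEOREM. For every number of modes `m`, every `R`-comparable symmetric cancelling table `α` supported on the
TWO-WAY nearest-neighbour shift set `S♭` at scale ratio `1+ε₀ > 1`, format-v2 gap data ON `S♭`
(`GapData₂On shiftSetFlat σ ε₀ i₀ α X₀ Z w r ρ θ₀ θ c₀ c env₀`) together with the thin-tail clause
`TailThin ε₀ w r` yield a margin `η > 0` and an epoch envelope `env` with BOTH clauses of a robust front step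
for the ball description: `FrontExistsOn shiftSetFlat` and `RobustStepOn shiftSetFlat`.

PROOF. The three-zone proof of K_B₂ (`…Theorems.GappedFrontRobust*`, p1 g9/g10, one-way `S`) transposed to a
general nearest-neighbour slot-closed shift set not containing the spurious class `(1,1,1)`
(`…Theorems.GappedFrontRobustOn*`, p1 g11/g12) and instantiated at `S♭`. The one point where backscatter
could have broken the architecture — the TAIL ZONE — stays one-directional when read against the TAIL
ENERGY: the half-line of shells `≥ K` exchanges energy only through the triads based at `K−1`, whose flux
involves the shells `K−1, K` only; the backscatter classes add a term linear in the energy above the bond,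
i.e. an exponential factor `≤ 2` far ahead of the front (`…TailEnergyOn/TailStepOn/TailZoneOn`). Every other
zone ports verbatim with `∑|α| ≤ m·m·|𝕊|` and the two-slot flux bound `P²Q + PQ²`
(`…FluxOn/BlockBehindOn/ExactEnvelopeOn/ActiveZoneOn/PseudoBoundsOn/RowSumOn/ClosenessOn/SelectionOn`), and
the constants are selected by `gappedFrontRobustV2On_closeness` (`…V2ClosenessOn`). Composition as for K_B₂:
exact flow from (exist₀), exact step with slack from `StepSlackOn`, (front) by `frontExistsOn_of_gapDataOn`,
(step) by `stepTo_transfer`. -/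

noncomputable section

-- the sub-problem namespace repeats the summit name by design (D-0017)
set_option linter.dupNamespace false

namespace Summit.NavierStokesRegularity.NavierStokesRegularity.Theorems

open Set Literature.Analysis.FluidPDE Literature.Analysis.FluidPDE.TaoCascade
open Summit.NavierStokesRegularity.NavierStokesRegularity.Theorems.GappedFrontRobustOn

/-- The spurious class `(1,1,1)` is not in `S♭` (the seven classes of `{0,1}³` modulo common translation).
[cite: Tao2016AveragedNS, §4 after (4.1); cell vocabulary, shift-set parametrised] -/
theorem not_mem_shiftSetFlat_one_one_one : ((1 : ℤ), (1 : ℤ), (1 : ℤ)) ∉ shiftSetFlat := by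
  intro h
  rcases (mem_shiftSetFlat_iff _).1 h with h | h | h | h | h | h | h <;>
    simp [Prod.ext_iff] at h

/-- **K_B♭ `GappedFrontRobustV2Flat` (stmt-NavierStokesRegularity-22988) BY NAME**: format-v2 gap data on `S♭`
with a thin tail yield a robust front step on `S♭` (both clauses, shared witnesses `η`, `env`) for the ball
description. [cite: Tao2016AveragedNS, §6.3–6.4 Props. 6.4–6.5 (statement shape); §4 Lemma 4.1 (4.5), (4.8)–(4.10)] -/
theorem taoLadderRungTwoFlat_gappedFrontRobustV2Flat_proof :
    Summit.NavierStokesRegularity.NavierStokesRegularity.Theses.TaoLadderRungTwoFlat.GappedFrontRobustV2Flat := by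
  intro m R σ ε₀ i₀ α X₀ Z w r ρ θ₀ θ c₀ c env₀ hα hε hgap hthin
  obtain ⟨η, hη, env, hdec, hclose⟩ :=
    gappedFrontRobustV2On_closeness isNearestNeighbourSet_shiftSetFlat isSlotClosed_shiftSetFlat
      not_mem_shiftSetFlat_one_one_one R σ ε₀ i₀ α X₀ Z w r ρ θ₀ θ c₀ c env₀ hα hε hgap hthin
  have hgap1 : GapDataOn shiftSetFlat ε₀ i₀ α X₀ Z w r ρ θ₀ θ c₀ c env₀ := hgap.1
  refine ⟨η, env, hη, frontExistsOn_of_gapDataOn hε hgap1 hη hdec, ?_⟩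
  -- the (step) clause
  intro L S₀ F₀ B₀ hball hB τ hτc S' F' hflow'
  obtain ⟨hr, hρ0, hρ1, hθ₀, hθ₀θ, hθ, hc₀, hc₀c, hw1, -, -, hex, -⟩ := hgap1
  obtain ⟨hσ, -, hslack, -⟩ := hgap.2
  -- the exact zero-slack flow on S♭ from the same ball state, on the clock window [0, c]
  obtain ⟨z, hz, hzr⟩ := hball
  obtain ⟨S, F, hSF⟩ := hex S₀ ⟨z, hz, hzr⟩
  -- its step with amplitude slack (StepSlackOn with horizon τ := c ≥ c₀)
  obtain ⟨τ₁, a, hstep, hmargin⟩ := hslack S₀ c S F ⟨z, hz, hzr⟩ hc₀c.le hSF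
  -- the three closeness facts
  obtain ⟨hfront, hballc, henv⟩ :=
    hclose L S₀ F₀ B₀ ⟨z, hz, hzr⟩ hB τ hτc S' F' hflow' S F hSF τ₁ a hstep hmargin
  -- transfer the step
  exact ⟨τ₁, a, GappedFrontRobust.stepTo_transfer hε.le hθ₀θ.le hc₀c.le
    (fun k => (zero_le_one.trans (hw1 k))) hstep (by linarith) hfront hballc henv⟩

end Summit.NavierStokesRegularity.NavierStokesRegularity.Theorems

end
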